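import Summits.HubbardSuperconductivity.HubbardSuperconductivity.Theorems.AnisotropyChordTransferFibre3ShellWeight
import Summits.HubbardSuperconductivity.HubbardSuperconductivity.Theorems.AnisotropyChordTransferFibre3ShellTermBounds

/-!
# Route `AnisotropyChord` / H0 rotor rung: PartN39 — ★ the SHELL MAJORANT `S(r,L;λ) ≤ |r|²(11.71 ln L + 5.9)/L²`, PROVED

PORT PartN39 (`…Fibre3RateLemma`, theory seat `hubbard-h0-rotor-theory-1` g21, memo 21 §321(a); THEOREMS M137) types
`RateLemma.ShellMajorant L` (the λ-half RATE lemma of the HOLE₂(.75) near-pair tail with explicit constants).  This file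
proves it (`shellMajorant_holds`) from the four ingredients (`…ShellIngredients`, `…LatticeSums`), the pointwise layer
(`…ShellTermBounds`) and the weight layer (`…ShellWeight`): each summand is dominated by the ℤ²-weight of its symmetric
representative (`summand_le_weight`); the representative map is injective into the box `|m|∞ ≤ L/2`, so the sum is at most
the weight-sum over `puncturedBox (L/2)`, `≤ C_far|r|²(4 ln N + 1) + (6/5)θ²|r|²/ε₁²`; with `λ ≤ (3/2)ε₁`,
`2θ²/π² ≤ ε₁ ≤ θ²/2`, `ln N ≤ ln L − ln 2` and the closing numerics this is `≤ |r|²(11.71 ln L + 5.9)/L²`.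
Prover seat `hubbard-h0-rotor-p2` g0; helper for stmt-HubbardSuperconductivity-19089 (`--supports`, helper class).
WHAT THIS IS NOT: nothing here proves superconductivity in the Hubbard model; helper lemma of ONE conditional reduction
(rung 19089, HOLE₂(.75) near-pair tail).  Mathlib + tree imports only; no sorry, no axioms.
-/

set_option linter.dupNamespace false

noncomputable section

namespace Summit.HubbardSuperconductivity.HubbardSuperconductivity.Theorems.AnisotropyChord.Transfer.Fibre3

namespace RateLemma

open Real Finset

variable (L : ℕ) [NeZero L]

/-! ## Pointwise domination of the summand -/

/-- every summand of `shellSum` is dominated by the weight of its representative (`8 ≤ L`, `λ ≤ (3/2)ε₁`). -/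
theorem summand_le_weight (hL : 8 ≤ L) (lam2 : ℝ) (hlam : lam2 ≤ 3 / 2 * eps1 L) (x y : ℤ) (k : Tor L) :
    (if k = 0 then (0 : ℝ)
      else min 2 ((kdotC L k (((x : ZMod L)), ((y : ZMod L)))) ^ 2 / 2)
        / ((2 * epsT L k) ^ 2 * (1 - lam2 / (2 * epsT L k))))
      ≤ shellWeight L x y (k.1.valMinAbs, k.2.valMinAbs) := by
  split_ifs with hk
  · exact shellWeight_nonneg L x y _
  have hε₁pos : 0 < eps1 L := lt_of_lt_of_le (by positivity) (eps1_ge_jordan L (by omega))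
  have hε : eps1 L ≤ epsT L k := eps1_le_epsT L (by omega) hk
  have hεne : epsT L k ≠ 0 := by linarith
  have hkd := kdotC_sq_le L k x y
  set M : ℝ := (((k.1.valMinAbs * x + k.2.valMinAbs * y : ℤ)) : ℝ) with hM
  unfold shellWeight
  simp only []
  by_cases h1 : k.1.valMinAbs.natAbs + k.2.valMinAbs.natAbs = 1
  · rw [if_pos h1]
    have hε1 : epsT L k = eps1 L := epsT_shellOne L k h1
    have := summand_le (epsT L k) lam2 _ (2 * Real.pi / L) M (eps1 L ^ 2) hεne (by positivity)
      (by rw [hε1]; exact den_shellOne (eps1 L) lam2 hlam hε₁pos.le) hkd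
    simpa [hM, mul_comm, mul_left_comm, mul_assoc] using this
  · rw [if_neg h1]
    by_cases h2 : k.1.valMinAbs.natAbs = 1 ∧ k.2.valMinAbs.natAbs = 1
    · rw [if_pos h2]
      have hε2 : epsT L k = 2 * eps1 L := epsT_shellTwo L k h2
      have := summand_le (epsT L k) lam2 _ (2 * Real.pi / L) M (10 * eps1 L ^ 2) hεne (by positivity)
        (by rw [hε2]; exact den_shellTwo (eps1 L) lam2 hlam hε₁pos.le) hkd
      have e : 2 * (10 * eps1 L ^ 2) = 20 * eps1 L ^ 2 := by ring
      rw [e] at this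
      exact this
    · rw [if_neg h2]
      -- far shell
      have hnot : k ∉ firstShells L := fun hmem =>
        (natAbs_of_mem_firstShells L (by omega) k hmem).elim h1 h2
      have hfar := shellFactorFar_holds L hL k hk hnot
      have hJ := jordanEpsLower_holds L k
      set J : ℝ := 2 / Real.pi ^ 2 * (2 * Real.pi / L) ^ 2 *
        ((((k.1.valMinAbs : ℤ) : ℝ)) ^ 2 + (((k.2.valMinAbs : ℤ) : ℝ)) ^ 2) with hJdef
      have hJ0 : 0 ≤ J := by positivity
      -- |m|² > 0 since k ≠ 0
      have hm0 : (0 : ℝ) < (((k.1.valMinAbs : ℤ) : ℝ)) ^ 2 + (((k.2.valMinAbs : ℤ) : ℝ)) ^ 2 := by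
        have : k.1.valMinAbs ≠ 0 ∨ k.2.valMinAbs ≠ 0 := by
          by_contra hcon
          push Not at hcon
          apply hk
          ext
          · simpa using (ZMod.valMinAbs_eq_zero k.1).1 hcon.1
          · simpa using (ZMod.valMinAbs_eq_zero k.2).1 hcon.2
        rcases this with h | h
        · have : (0 : ℝ) < (((k.1.valMinAbs : ℤ) : ℝ)) ^ 2 := by positivity
          linarith [sq_nonneg (((k.2.valMinAbs : ℤ) : ℝ))]
        · have : (0 : ℝ) < (((k.2.valMinAbs : ℤ) : ℝ)) ^ 2 := by positivity
          linarith [sq_nonneg (((k.1.valMinAbs : ℤ) : ℝ))]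
      have hLpos : (0 : ℝ) < L := by exact_mod_cast (show 0 < L by omega)
      have hJpos : 0 < J := by positivity
      have ha : (0 : ℝ) < 2 - 1.5 / 3.414 := by norm_num
      have hc : 0 < 2 * (2 - 1.5 / 3.414) * J ^ 2 := by positivity
      have := summand_le (epsT L k) lam2 _ (2 * Real.pi / L) M (2 * (2 - 1.5 / 3.414) * J ^ 2) hεne hc
        (den_far (epsT L k) (eps1 L) lam2 J hlam hε₁pos.le hfar hJ0 hJ) hkd
      refine le_trans this (le_of_eq ?_)
      unfold farCoeff
      rw [hJdef]
      have hπ : Real.pi ≠ 0 := Real.pi_ne_zero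
      have hsq : ((((k.1.valMinAbs ^ 2 + k.2.valMinAbs ^ 2 : ℤ)) : ℝ))
          = (((k.1.valMinAbs : ℤ) : ℝ)) ^ 2 + (((k.2.valMinAbs : ℤ) : ℝ)) ^ 2 := by push_cast; ring
      rw [hsq]
      field_simp
      ring

/-! ## The theorem -/

/-- ★ `ShellMajorant` holds: `8 ≤ L`, `0 ≤ λ ≤ (3/2)ε₁` ⇒ `S(r,L;λ) ≤ |r|²(11.71 ln L + 5.9)/L²`. -/
theorem shellMajorant_holds : ShellMajorant L := by
  intro hL lam2 hlam0 hlam x y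
  set N : ℕ := L / 2 with hNdef
  have hN1 : 1 ≤ N := by omega
  have hLpos : (0 : ℝ) < L := by exact_mod_cast (show 0 < L by omega)
  set θ : ℝ := 2 * Real.pi / L with hθ
  set ρ : ℝ := (x : ℝ) ^ 2 + (y : ℝ) ^ 2 with hρ
  have hρ0 : 0 ≤ ρ := by positivity
  have hθpos : 0 < θ := by positivity
  have hεJ : 2 / Real.pi ^ 2 * θ ^ 2 ≤ eps1 L := eps1_ge_jordan L (by omega)
  have hε₁pos : 0 < eps1 L := lt_of_lt_of_le (by positivity) hεJ
  have hεhalf : eps1 L ≤ θ ^ 2 / 2 := eps1_le_half_theta_sq L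
  have hCf := farCoeff_nonneg L
  -- Step 1: the sum is at most the weight-sum over the punctured box
  set box : Finset (ℤ × ℤ) := (Finset.Icc (-(N : ℤ)) N) ×ˢ (Finset.Icc (-(N : ℤ)) N) with hbox
  have hT : (∑ k : Tor L, (if k = 0 then (0 : ℝ)
      else min 2 ((kdotC L k (((x : ZMod L)), ((y : ZMod L)))) ^ 2 / 2)
        / ((2 * epsT L k) ^ 2 * (1 - lam2 / (2 * epsT L k)))))
      ≤ ∑ m ∈ puncturedBox N, shellWeight L x y m := by
    have s1 : (∑ k : Tor L, (if k = 0 then (0 : ℝ)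
        else min 2 ((kdotC L k (((x : ZMod L)), ((y : ZMod L)))) ^ 2 / 2)
          / ((2 * epsT L k) ^ 2 * (1 - lam2 / (2 * epsT L k)))))
        ≤ ∑ k : Tor L, shellWeight L x y (k.1.valMinAbs, k.2.valMinAbs) :=
      Finset.sum_le_sum (fun k _ => summand_le_weight L hL lam2 hlam x y k)
    have s2 : (∑ k : Tor L, shellWeight L x y (k.1.valMinAbs, k.2.valMinAbs))
        = ∑ m ∈ (Finset.univ : Finset (Tor L)).image (fun k : Tor L => (k.1.valMinAbs, k.2.valMinAbs)),
            shellWeight L x y m := by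
      rw [Finset.sum_image (fun a _ b _ h => rep_injective L h)]
    have s3 : (Finset.univ : Finset (Tor L)).image (fun k : Tor L => (k.1.valMinAbs, k.2.valMinAbs)) ⊆ box := by
      rw [Finset.image_subset_iff]
      intro k _
      rw [hbox]
      exact rep_mem_box L k
    have s4 : (∑ m ∈ (Finset.univ : Finset (Tor L)).image (fun k : Tor L => (k.1.valMinAbs, k.2.valMinAbs)),
            shellWeight L x y m) ≤ ∑ m ∈ box, shellWeight L x y m :=
      Finset.sum_le_sum_of_subset_of_nonneg s3 (fun m _ _ => shellWeight_nonneg L x y m)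
    have h0mem : ((0 : ℤ), (0 : ℤ)) ∈ box := by rw [hbox]; simp
    have s5 : (∑ m ∈ box, shellWeight L x y m) = ∑ m ∈ puncturedBox N, shellWeight L x y m := by
      have hpb : puncturedBox N = box.erase ((0 : ℤ), (0 : ℤ)) := rfl
      rw [hpb, ← Finset.sum_erase_add box _ h0mem]
      have hz : shellWeight L x y ((0 : ℤ), (0 : ℤ)) = 0 := by
        unfold shellWeight; simp
      rw [hz, add_zero]
    calc _ ≤ _ := s1
      _ = _ := s2
      _ ≤ _ := s4
      _ = _ := s5
  -- Step 2: the weight-sum bound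
  have hW := sum_shellWeight_le L N hN1 x y
  -- Step 3: assemble `shellSum = λ · T / L²`
  unfold shellSum
  have hTnn : 0 ≤ ∑ m ∈ puncturedBox N, shellWeight L x y m :=
    Finset.sum_nonneg (fun m _ => shellWeight_nonneg L x y m)
  have hlogN : Real.log N ≤ Real.log L - Real.log 2 := by
    have hN0 : (0 : ℝ) < N := by exact_mod_cast (show 0 < N by omega)
    have hNle : (N : ℝ) ≤ (L : ℝ) / 2 := by
      have : 2 * N ≤ L := by omega
      have : (2 : ℝ) * N ≤ L := by exact_mod_cast this
      linarith
    have := Real.log_le_log hN0 hNle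
    rw [Real.log_div (by positivity) (by norm_num)] at this
    exact this
  have hlogN0 : 0 ≤ Real.log N := Real.log_nonneg (by exact_mod_cast hN1)
  have hlogL0 : 0 ≤ Real.log L := Real.log_nonneg (by exact_mod_cast (show 1 ≤ L by omega))
  -- the bound B on the weight-sum, then λ·T/L² ≤ (3/2)ε₁·B/L²
  set B : ℝ := farCoeff L * ρ * (4 * Real.log N + 1) + (6 / 5) * θ ^ 2 * ρ / eps1 L ^ 2 with hB
  have hB0 : 0 ≤ B := by positivity
  have hT' : (∑ k : Tor L, (if k = 0 then (0 : ℝ)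
      else min 2 ((kdotC L k (((x : ZMod L)), ((y : ZMod L)))) ^ 2 / 2)
        / ((2 * epsT L k) ^ 2 * (1 - lam2 / (2 * epsT L k))))) ≤ B := le_trans hT hW
  have step1 : lam2 * (∑ k : Tor L, (if k = 0 then (0 : ℝ)
      else min 2 ((kdotC L k (((x : ZMod L)), ((y : ZMod L)))) ^ 2 / 2)
        / ((2 * epsT L k) ^ 2 * (1 - lam2 / (2 * epsT L k))))) / (L : ℝ) ^ 2
      ≤ (3 / 2 * eps1 L) * B / (L : ℝ) ^ 2 := by
    apply div_le_div_of_nonneg_right _ (by positivity)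
    calc lam2 * _ ≤ lam2 * B := mul_le_mul_of_nonneg_left hT' hlam0
      _ ≤ (3 / 2 * eps1 L) * B := mul_le_mul_of_nonneg_right hlam hB0
  refine le_trans step1 ?_
  apply div_le_div_of_nonneg_right _ (by positivity)
  -- (3/2)ε₁·B ≤ ρ (11.71 ln L + 5.9)
  -- (i)  (3/2)ε₁·C_far ≤ 3π⁴/(64a)
  have hi : 3 / 2 * eps1 L * farCoeff L ≤ 3 * Real.pi ^ 4 / (64 * (2 - 1.5 / 3.414)) := by
    have ha : (0 : ℝ) < 2 - 1.5 / 3.414 := by norm_num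
    unfold farCoeff
    rw [show 3 / 2 * eps1 L * (Real.pi ^ 4 / (16 * (2 - 1.5 / 3.414) * (2 * Real.pi / ↑L) ^ 2))
        = eps1 L * (3 * Real.pi ^ 4 / (32 * (2 - 1.5 / 3.414))) / θ ^ 2 by rw [hθ]; field_simp; ring]
    rw [div_le_iff₀ (by positivity)]
    have : eps1 L * (3 * Real.pi ^ 4 / (32 * (2 - 1.5 / 3.414)))
        ≤ θ ^ 2 / 2 * (3 * Real.pi ^ 4 / (32 * (2 - 1.5 / 3.414))) :=
      mul_le_mul_of_nonneg_right hεhalf (by positivity)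
    have e : θ ^ 2 / 2 * (3 * Real.pi ^ 4 / (32 * (2 - 1.5 / 3.414)))
        = 3 * Real.pi ^ 4 / (64 * (2 - 1.5 / 3.414)) * θ ^ 2 := by ring
    linarith [e]
  -- (ii) (3/2)ε₁ · (6/5)θ²/ε₁² = (9/5)θ²/ε₁ ≤ (9/10)π²
  have hii : 3 / 2 * eps1 L * ((6 / 5) * θ ^ 2 * ρ / eps1 L ^ 2) ≤ 9 / 10 * Real.pi ^ 2 * ρ := by
    rw [show 3 / 2 * eps1 L * ((6 / 5) * θ ^ 2 * ρ / eps1 L ^ 2) = (9 / 5) * θ ^ 2 / eps1 L * ρ by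
      field_simp; ring]
    apply mul_le_mul_of_nonneg_right _ hρ0
    rw [div_le_iff₀ hε₁pos]
    have : 9 / 10 * Real.pi ^ 2 * (2 / Real.pi ^ 2 * θ ^ 2) = 9 / 5 * θ ^ 2 := by
      field_simp; ring
    nlinarith [hεJ, Real.pi_pos]
  -- (iii) numerics
  have hnum := numeric_final (Real.log L) hlogL0
  have hΛ : 4 * Real.log N + 1 ≤ 4 * Real.log L - 4 * Real.log 2 + 1 := by linarith
  set K : ℝ := 3 * Real.pi ^ 4 / (64 * (2 - 1.5 / 3.414)) with hK
  have hK0 : 0 ≤ K := by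
    have ha : (0 : ℝ) < 2 - 1.5 / 3.414 := by norm_num
    positivity
  have hmain : 3 / 2 * eps1 L * B ≤ ρ * (K * (4 * Real.log L - 4 * Real.log 2 + 1) + 9 / 10 * Real.pi ^ 2) := by
    rw [hB]
    have t1 : 3 / 2 * eps1 L * (farCoeff L * ρ * (4 * Real.log N + 1))
        ≤ K * (4 * Real.log L - 4 * Real.log 2 + 1) * ρ := by
      have u1 : 3 / 2 * eps1 L * (farCoeff L * ρ * (4 * Real.log N + 1))
          = (3 / 2 * eps1 L * farCoeff L) * (4 * Real.log N + 1) * ρ := by ring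
      rw [u1]
      apply mul_le_mul_of_nonneg_right _ hρ0
      have hx1 : 0 ≤ 3 / 2 * eps1 L * farCoeff L := by positivity
      have hx2 : 0 ≤ 4 * Real.log N + 1 := by linarith
      calc (3 / 2 * eps1 L * farCoeff L) * (4 * Real.log N + 1)
          ≤ K * (4 * Real.log N + 1) := mul_le_mul_of_nonneg_right hi hx2
        _ ≤ K * (4 * Real.log L - 4 * Real.log 2 + 1) := mul_le_mul_of_nonneg_left hΛ hK0
    nlinarith [t1, hii]
  calc 3 / 2 * eps1 L * B ≤ ρ * (K * (4 * Real.log L - 4 * Real.log 2 + 1) + 9 / 10 * Real.pi ^ 2) := hmain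
    _ ≤ ρ * (11.71 * Real.log L + 5.9) := mul_le_mul_of_nonneg_left hnum hρ0
    _ = ((x : ℝ) ^ 2 + (y : ℝ) ^ 2) * (11.71 * Real.log L + 5.9) := by rw [hρ]

end RateLemma

end Summit.HubbardSuperconductivity.HubbardSuperconductivity.Theorems.AnisotropyChord.Transfer.Fibre3

end
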